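import Summits.ValiantsHypothesis.ValiantsHypothesis.Theorems.GrenetZeonDualUnipotentThreeHalvesHeavyTopXElevenBoundZero
import Summits.ValiantsHypothesis.ValiantsHypothesis.Theorems.GrenetZeonDualUnipotentThreeHalvesHeavyTopXElevenBoundOne
import Summits.ValiantsHypothesis.ValiantsHypothesis.Theorems.GrenetZeonDualUnipotentThreeHalvesHeavyTopXElevenBoundThree

/-!
# `GrenetZeon.DualUnipotentThreeHalves` (stmt-ValiantsHypothesis-24318), R2 heavy-top instrument — the `(5,9)` ✗-cell X11, KERNEL ROUTE part 9:
# `¬ HeavyTopInst 5 9` MODULO THE ONE MISSING BOUND `D₂ ≤ 15`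

Experiment cell «val-heavytop-census» (D-0160), engine seat val-htc-eng-2 g5.  Three of the four dimension bounds of the power-currency obstruction on the
coordinate section `W₀ = B ∩ {y = n04 = 0}` are kernel theorems (✓ `finrank_le_two_of_wordsum1` `k = 0`, ✓ `finrank_le_ten_of_wordsums` `k = 1`,
✓ `finrank_le_twenty_of_wordsums` `k = 3`); the `k = 2` bound `D₂ ≤ 15` (machine: CENSUS-X11-NOT-SLOW §2/§3 and kit j328194 for `W₀`) is NOT yet typed.
THIS FILE isolates exactly that debt: `not_heavyTopInst_five_nine_of_boundTwo` — IF every `K ≤ ℂ^{5×5}` on which all length-`4` word sums in `(FX x, FX v)`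
with `j ≥ 3` letters `FX v` (`v ∈ K`) vanish has `dim K ≤ 15`, THEN `¬ HeavyTopInst 5 9` (✓ `wordsums_w0` + `interval_cases` + the three kernel bounds).
When `…HeavyTopXElevenBoundTwo.finrank_le_fifteen_of_wordsums` lands, the unconditional theorem is the one-liner
`not_heavyTopInst_five_nine_of_boundTwo finrank_le_fifteen_of_wordsums` (assembly file `…XElevenNotFiveNine`, written).

Honest framing: a CONDITIONAL kernel statement for ONE census cell (`C₀ = 1` sliver); its hypothesis is an explicit finite-dimensional linear-algebra
statement (no named open problem); nothing here proves or refutes `HeavyTopLaw`/`HeavyTopSlowLaw`, 24318, S3 or 8062; `HeavyTopInst 5 9` is NOT decided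
unconditionally by this file; `VP ≠ VNP` is NOT proved.  No definitions.  [this seat]
-/

-- single-conjunct layout: Sub = Summit, duplicated namespace component intended
set_option linter.dupNamespace false
set_option autoImplicit false

namespace Summit.ValiantsHypothesis.ValiantsHypothesis.Theorems.GrenetZeon.HeavyTopXElevenNotFiveNine

open Matrix
open scoped BigOperators
open Summit.ValiantsHypothesis.ValiantsHypothesis.Theorems.GrenetZeon.RadicalSplit (gword HeavyTopInst)
open Summit.ValiantsHypothesis.ValiantsHypothesis.Theorems.GrenetZeon.HeavyTopXElevenSection (wordsums_w0)
open Summit.ValiantsHypothesis.ValiantsHypothesis.Theorems.GrenetZeon.HeavyTopXElevenBoundZero (finrank_le_two_of_wordsum1)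
open Summit.ValiantsHypothesis.ValiantsHypothesis.Theorems.GrenetZeon.HeavyTopXElevenBoundOne (finrank_le_ten_of_wordsums)
open Summit.ValiantsHypothesis.ValiantsHypothesis.Theorems.GrenetZeon.HeavyTopXElevenBoundThree (finrank_le_twenty_of_wordsums)

/-- ★ **`¬ HeavyTopInst 5 9` modulo `D₂ ≤ 15`.**  If the `k = 2` dimension bound on `W₀` holds (every `K` with all `j ≥ 3` word sums vanishing along `K`
has `dim K ≤ 15`), then the census cell `(5,9)` is FALSE: ✓ `wordsums_w0` gives `K`, `k ≤ 3`, `5k + 6 ≤ dim K`, contradicted for `k = 0, 1, 3` by the three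
kernel bounds and for `k = 2` by the hypothesis. -/
theorem not_heavyTopInst_five_nine_of_boundTwo
    (hD2 : ∀ K : Submodule ℂ (Fin 5 × Fin 5 → ℂ),
      (∀ x v : Fin 5 × Fin 5 → ℂ, v ∈ K → ∀ j : ℕ, 2 < j → ∀ i i' : Fin 9,
        (∑ f ∈ Finset.univ.filter (fun f : Fin 4 → Bool => (List.ofFn f).count true = j),
            gword (!![0, x (0, 0), x (0, 1), x (0, 2), x (0, 3), x (0, 4), x (1, 0), x (1, 1), 0; 0, 0, x (1, 2), x (1, 3), x (1, 4), 0, 0, 0, x (3, 3); 0, 0, 0, x (2, 0), x (2, 1), x (2, 2), 0, 0, x (3, 4); 0, 0, 0, 0, x (2, 3), x (2, 4), 0, 0, x (4, 0); 0, 0, 0, 0, 0, x (3, 0), 0, 0, x (4, 1); 0, 0, 0, 0, 0, 0, x (3, 2), -x (3, 1), x (4, 2); 0, x (3, 1), 0, 0, 0, 0, 0, 0, x (4, 3); 0, x (3, 2), 0, 0, 0, 0, 0, 0, x (4, 4); 0, 0, 0, 0, 0, 0, 0, 0, 0] : Matrix (Fin 9) (Fin 9) ℂ) (!![0, v (0,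 0), v (0, 1), v (0, 2), v (0, 3), v (0, 4), v (1, 0), v (1, 1), 0; 0, 0, v (1, 2), v (1, 3), v (1, 4), 0, 0, 0, v (3, 3); 0, 0, 0, v (2, 0), v (2, 1), v (2, 2), 0, 0, v (3, 4); 0, 0, 0, 0, v (2, 3), v (2, 4), 0, 0, v (4, 0); 0, 0, 0, 0, 0, v (3, 0), 0, 0, v (4, 1); 0, 0, 0, 0, 0, 0, v (3, 2), -v (3, 1), v (4, 2); 0, v (3, 1), 0, 0, 0, 0, 0, 0, v (4, 3); 0, v (3, 2), 0, 0, 0, 0, 0, 0, v (4, 4); 0, 0, 0, 0, 0, 0, 0, 0, 0] : Matrix (Fin 9) (Fin 9) ℂ) (List.ofFn f)) i i' = 0) → Module.finrank ℂ K ≤ 15) :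
    ¬ HeavyTopInst 5 9 := by
  intro h
  obtain ⟨K, k, hk, hdim, hK⟩ := wordsums_w0 h
  interval_cases k
  · have h0 := finrank_le_two_of_wordsum1 K (fun x v hv i i' => hK x v hv 1 (by norm_num) i i')
    omega
  · have h1 := finrank_le_ten_of_wordsums K hK
    omega
  · have h2 := hD2 K hK
    omega
  · have h3 := finrank_le_twenty_of_wordsums K hK
    omega

end Summit.ValiantsHypothesis.ValiantsHypothesis.Theorems.GrenetZeon.HeavyTopXElevenNotFiveNine
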